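import Literature.NumberTheory.LFunctions.SmoothedExplicitFormulaCharContour
import Literature.NumberTheory.LFunctions.DeuringHeilbronnTestFunction
import HarnessLib

/-!
# The positivity device `Σ Λ(n)(1 + χ₁(n))(1 + Re n^{−iγ}) n^{−σ} g(log n) ≥ 0`

Topic `Literature/NumberTheory/LFunctions`, sub-namespace `DHTest`. Everything here is PROVED
(no definitions).

Heath-Brown 1992, §6, (6.4): for a real character `χ₁` and real `σ, γ`,
`0 ≤ Σ_n Λ(n) (1 + χ₁(n)) (1 + Re n^{−iγ}) n^{−σ} g(log n) = K₁ + K₂ + K₃ + K₄`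
with `K₁ = Re K_g(σ)` (`ζ`), `K₂ = Re K_{g,χ₁}(σ)`, `K₃ = Re K_g(σ + iγ)`, `K₄ = Re K_{g,χ₁}(σ + iγ)`
(`fordK`, `ExplicitPsiChar.charFordK`). We prove `sum_re_fordK_nonneg`:
`0 ≤ Re K_g(σ) + Re K_{g,χ}(σ) + Re K_g(σ+iγ) + Re K_{g,χ}(σ+iγ)` for every quadratic
(real-valued) Dirichlet character `χ`, every non-negative `g` vanishing on `[X, ∞)` and all real
`σ, γ` — each summand is `Λ(n) g(log n) (1 + χ(n)) Re(n^{−σ} + n^{−σ−iγ}) ≥ 0` since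
`|n^{−σ−iγ}| = n^{−σ}`.

## References

* D. R. Heath-Brown, Proc. London Math. Soc. (3) 64 (1992), §6 (6.4) and Lemma 6.1 (proof).
  [cite: HeathBrown1992PLMS, Section 6 (6.4)]
-/

noncomputable section

open Complex Real Finset ArithmeticFunction

namespace Literature.NumberTheory.LFunctions

namespace DHTest

open ExplicitPsiChar

variable {q : ℕ}

/-- `Re(n^{−σ} + n^{−(σ+iγ)}) ≥ 0` for `n ≥ 1` and real `σ, γ` (`|n^{−σ−iγ}| = n^{−σ}`). [folklore] -/
theorem re_cpow_add_cpow_nonneg {n : ℕ} (hn : 1 ≤ n) (σ γ : ℝ) :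
    0 ≤ ((n : ℂ) ^ (-(σ : ℂ)) + (n : ℂ) ^ (-((σ : ℂ) + γ * I))).re := by
  have hn0 : 0 < (n : ℝ) := by exact_mod_cast hn
  have h1 : ((n : ℂ) ^ (-(σ : ℂ))) = (((n : ℝ) ^ (-σ) : ℝ) : ℂ) := by
    rw [show (-(σ : ℂ)) = ((-σ : ℝ) : ℂ) by push_cast; ring, ← Complex.ofReal_natCast,
      ← Complex.ofReal_cpow hn0.le]
  have h2 : ‖(n : ℂ) ^ (-((σ : ℂ) + γ * I))‖ = (n : ℝ) ^ (-σ) := by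
    rw [Complex.norm_natCast_cpow_of_pos hn]
    simp
  rw [Complex.add_re, h1, Complex.ofReal_re]
  have h3 : -‖(n : ℂ) ^ (-((σ : ℂ) + γ * I))‖ ≤ ((n : ℂ) ^ (-((σ : ℂ) + γ * I))).re :=
    (neg_le_abs _).trans (Complex.abs_re_le_norm _) |> fun h ↦ by linarith [neg_abs_le ((n : ℂ) ^ (-((σ : ℂ) + γ * I))).re, Complex.abs_re_le_norm ((n : ℂ) ^ (-((σ : ℂ) + γ * I)))]
  rw [h2] at h3
  linarith

/-- A quadratic character takes the real values `0, ±1`: `χ(n) = r` with `r ∈ {0, 1, −1}`, so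
`1 + χ(n)` is a non-negative real. [folklore] -/
theorem exists_real_eq_of_isQuadratic {χ : DirichletCharacter ℂ q} (hχ : χ.IsQuadratic) (n : ℕ) :
    ∃ r : ℝ, (χ n : ℂ) = r ∧ 0 ≤ 1 + r := by
  rcases hχ (n : ZMod q) with h | h | h
  · exact ⟨0, by rw [h]; simp, by norm_num⟩
  · exact ⟨1, by rw [h]; simp, by norm_num⟩
  · exact ⟨-1, by rw [h]; simp, by norm_num⟩

/-- **The positivity device** (Heath-Brown 1992, (6.4)): for a quadratic character `χ`, a
non-negative `g` vanishing on `[X, ∞)` and real `σ, γ`,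
`0 ≤ Re K_g(σ) + Re K_{g,χ}(σ) + Re K_g(σ + iγ) + Re K_{g,χ}(σ + iγ)`.
[cite: HeathBrown1992PLMS, Section 6 (6.4)] -/
theorem sum_re_fordK_nonneg {χ : DirichletCharacter ℂ q} (hχ : χ.IsQuadratic) {g : ℝ → ℝ} {X : ℝ}
    (hg0 : ∀ u, 0 ≤ g u) (hgX : ∀ u, X ≤ u → g u = 0) (σ γ : ℝ) :
    0 ≤ (fordK g σ).re + (charFordK χ g σ).re + (fordK g ((σ : ℂ) + γ * I)).re +
      (charFordK χ g ((σ : ℂ) + γ * I)).re := by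
  -- a common truncation `N`
  obtain ⟨N, hN1, hNX⟩ : ∃ N : ℕ, 1 ≤ N ∧ X ≤ Real.log N := by
    refine ⟨⌊Real.exp X⌋₊ + 1, by omega, ?_⟩
    have h : Real.exp X ≤ (⌊Real.exp X⌋₊ + 1 : ℕ) := by
      push_cast; exact (Nat.lt_floor_add_one _).le
    calc X = Real.log (Real.exp X) := (Real.log_exp X).symm
      _ ≤ Real.log ((⌊Real.exp X⌋₊ + 1 : ℕ)) := Real.log_le_log (Real.exp_pos X) h
  rw [fordK_eq_sum hgX hN1 hNX, fordK_eq_sum hgX hN1 hNX, charFordK_eq_sum χ hgX hN1 hNX,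
    charFordK_eq_sum χ hgX hN1 hNX, Complex.re_sum, Complex.re_sum, Complex.re_sum, Complex.re_sum,
    ← Finset.sum_add_distrib, ← Finset.sum_add_distrib, ← Finset.sum_add_distrib]
  refine Finset.sum_nonneg fun n _ ↦ ?_
  rcases Nat.eq_zero_or_pos n with rfl | hn
  · simp
  obtain ⟨r, hr, hr0⟩ := exists_real_eq_of_isQuadratic hχ n
  -- the summand is `Λ(n) g(log n) (1 + r) Re(n^{-σ} + n^{-(σ+iγ)})`
  have hΛ : 0 ≤ (vonMangoldt n : ℝ) := vonMangoldt_nonneg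
  have hgn : 0 ≤ g (Real.log n) := hg0 _
  have hre := re_cpow_add_cpow_nonneg hn σ γ
  have key : (((vonMangoldt n : ℝ) : ℂ) * (g (Real.log n) : ℂ) * (n : ℂ) ^ (-(σ : ℂ))).re +
      (((vonMangoldt n : ℝ) : ℂ) * χ n * (g (Real.log n) : ℂ) * (n : ℂ) ^ (-(σ : ℂ))).re +
      (((vonMangoldt n : ℝ) : ℂ) * (g (Real.log n) : ℂ) * (n : ℂ) ^ (-((σ : ℂ) + γ * I))).re +
      (((vonMangoldt n : ℝ) : ℂ) * χ n * (g (Real.log n) : ℂ) * (n : ℂ) ^ (-((σ : ℂ) + γ * I))).re =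
      (vonMangoldt n : ℝ) * g (Real.log n) * (1 + r) *
        ((n : ℂ) ^ (-(σ : ℂ)) + (n : ℂ) ^ (-((σ : ℂ) + γ * I))).re := by
    rw [hr]
    have e : ∀ z : ℂ, (((vonMangoldt n : ℝ) : ℂ) * (g (Real.log n) : ℂ) * z).re =
        (vonMangoldt n : ℝ) * g (Real.log n) * z.re := by
      intro z
      rw [show ((vonMangoldt n : ℝ) : ℂ) * (g (Real.log n) : ℂ) = (((vonMangoldt n : ℝ) * g (Real.log n) : ℝ) : ℂ) by
        push_cast; ring, Complex.re_ofReal_mul]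
    have e' : ∀ z : ℂ, (((vonMangoldt n : ℝ) : ℂ) * (r : ℂ) * (g (Real.log n) : ℂ) * z).re =
        (vonMangoldt n : ℝ) * g (Real.log n) * r * z.re := by
      intro z
      rw [show ((vonMangoldt n : ℝ) : ℂ) * (r : ℂ) * (g (Real.log n) : ℂ) =
        (((vonMangoldt n : ℝ) * g (Real.log n) * r : ℝ) : ℂ) by push_cast; ring, Complex.re_ofReal_mul]
    rw [e, e', e, e', Complex.add_re]
    ring
  rw [key]
  have : 0 ≤ (vonMangoldt n : ℝ) * g (Real.log n) * (1 + r) := by positivity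
  exact mul_nonneg this hre

end DHTest

end Literature.NumberTheory.LFunctions

end
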